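import Summits.QuantumFields.YangMills.Theorems.UnitScaleTiltProp7OneFormAgmonPhaseClass
import Summits.QuantumFields.YangMills.Theorems.UnitScaleTiltProp7QkAdjointSupRowOfRegPr
import Summits.QuantumFields.YangMills.Theorems.UnitScaleTiltProp7OneFormAgmon
import HarnessLib

/-!
# Route `UnitScaleTilt`, crux K1 «MinimiserStabilityRegPr» (stmt-QuantumFields-19200), EX rows `h137kπ` ∕ `h137kΔ` ∕ `hCk` — **K-STOREY BRICK (K2b-δ₁δ₂) (px12 g17, LOCATE-K137 529f36ee road
# (K2)): THE `Q_k` WEIGHT-CONJUGATION LETTERS IN OPERATOR NORM** — the two hypotheses `hA : ‖M(Q_k(M_fi x)) − Q_k x‖ ≤ δ₁‖x‖` and `hC : ‖M_f(Q_k†(M_i c)) − Q_k† c‖ ≤ δ₂‖c‖` of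
# ✓p767718 `Prop7KinvConjugateDecay.conj_accretive_of_letters`, DISCHARGED at a printed-regular background for every positive site weight `w` whose read-set relative oscillations are
# `≤ ρ_Q` (coarse multiplier `w(x_r ĉ)` at reference sites, fine multiplier `w(b₋)`), with **`δ₁ = δ₂ = √(216·ρ_Q²·(cB∕(c₀ℓ³)))`**; and the block-distance exponential edition `w = e^{φ}`,
# `|φ x − φ x′| ≤ r·η·tdist x x′`, reference sites in the source blocks: `ρ_Q = e^{r(d+1)} − 1` — K-FREE at the pin `cB = c₀ℓ³`, `→ 0` with the slope `r`.

Cell `ym3-torus` (HUMAN RULING D-0037: SU(2) YM₃ on T³ is ladder rung R3 — NOT d = 4, NOT infinite volume, NOT a mass gap, NOT Clay).  Width seat `ym3-torus-px12` gen 17.  THEOREMS ONLY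
(0 `def`, 0 `sorry`, default heartbeats); `--supports stmt-QuantumFields-19200 --as helper`, count-neutral.  HONEST LABEL: the engine is px21 g14's A2b ✓`Prop7OneFormAgmonAveraging`
(`QTwS_smul_eq_ref`, `sum_normSq_entries_QTwS_relComm_le` — two-block locality + FILE 1b + read-set multiplicity) and A2e ✓`Prop7OneFormAgmonWeights.readSet_ratio_exp_le`; this file is the
operator-norm READING of that carrier row (A2b §6 read it as a form bound) plus `⟪·,·⟫`-duality for the adjoint letter; the multiplication operators are HYPOTHESIS-DESCRIBED linear maps (rows
`hM`∕`hMi`∕`hMf`∕`hMfi`, as in ✓p767718 §2 — no definitions), their existence is ∃-packaged (§2).  Nothing of δ₃ (the one-form conjugated resolvent), `m₀`, (3.132), `h137kπ`, `h137kΔ`, `hCk`,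
EX or 19200 is proved here.

WHAT IS PROVED (ns `Summit.QuantumFields.YangMills.Theorems.Prop7QkWeightConjugation`; member `F`, `h : n ≤ K`, weights `c₀ cB`).
* §1 (abstract) ★ `norm_le_of_adjoint_pair` — `⟪Tx, c⟫ = ⟪x, Sc⟫` and `‖Tx‖ ≤ δ‖x‖` ⟹ `‖Sc‖ ≤ δ‖c‖`.
* §2 (multiplication operators by real weights, described by their action on `toL2B Z` ∕ `toL2 X`) `exists_weightOpB`, `weightB_comp_apply` (`w₂w₁ = 1` ⟹ `M₂(M₁ g) = g`), ★ `inner_weightB_comm`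
  (`⟪Mg, g′⟫ = ⟪g, Mg′⟫`); the fine twins (∃-package = A3 ✓`Prop7OneFormAgmon.exists_smulBond`) `weight_comp_apply`, ★ `inner_weight_comm`; `norm_adjoint_Qk_le_of_regPr`
  (`‖Q_k† c‖ ≤ 6√(cB∕c₀)√(ℓ⁻³)‖c‖`, the `hQadj` row, from px17 ✓`norm_Qk_le_of_regPr` by §1).
* §3 `norm_eta_smul_toL2B_le` (the `L²` size of `η•toL2B E` from A2b's carrier row: `≤ √(216ρ_Q²(cB∕(c₀ℓ³)))·‖toL2 X‖`, `η²ℓ² = 1`), ★ `weight_Qk_weight_sub_eq` (for a fine multiplier `v(b₋)`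
  and a coarse multiplier `w_c` with `w_c(ĉ)·v(x_r ĉ) = 1`: `B(Q_k(A(toL2 X))) − Q_k(toL2 X) = η•toL2B E_v`, `E_v ĉ = QTwS((v(b₋)∕v(x_r ĉ) − 1)·X) ĉ`), ★★ `norm_weight_Qk_weight_sub_le`
  (`RegPr` + routeR-w4's windows + `|v(b₋)∕v(x_r ĉ) − 1| ≤ ρ_Q` on the read set ⟹ `‖B(Q_k(Ax)) − Q_k x‖ ≤ √(216ρ_Q²(cB∕(c₀ℓ³)))·‖x‖`).
* §4 ★★★ `qkWeightConj_letters_of_regPr` — for ONE positive site weight `w`, reference sites `x_r`, both read-set ratios `≤ ρ_Q`, and the four operators `M ↔ w(x_r ĉ)`, `M_i ↔ w(x_r ĉ)⁻¹`,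
  `M_f ↔ w(b₋)`, `M_fi ↔ w(b₋)⁻¹`: **(hA) `∀ x, ‖M(Q_k(M_fi x)) − Q_k x‖ ≤ δ‖x‖` ∧ (hC) `∀ c, ‖M_f(Q_k†(M_i c)) − Q_k† c‖ ≤ δ‖c‖`, `δ = √(216ρ_Q²(cB∕(c₀ℓ³)))`** — VERBATIM the `hA`∕`hC` of
  ✓`conj_accretive_of_letters` (`Q := Qk U₀`, `Qadj := LinearMap.adjoint (Qk U₀)`); ★★★ `qkWeightConj_letters_exp_of_regPr` (`w = e^{φ}`, `|φ x − φ x′| ≤ rη·tdist x x′`, `x_r ĉ ∈ ĉ₋`: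
  `ρ_Q = e^{r(d+1)} − 1`), ★★ `qkWeightConj_letters_exp_corner_of_regPr` (reference sites := the block corners, A2g ✓`iterBlockOf_src_corner`).
HYP-SAT (★★OWNER RULING №42): `RegPr` + the two windows exactly as A2b (inhabited on the literal T³ families for `ε₀ ≤ αcap L`); the operator rows are inhabited by §2's ∃-package `exists_weightOpB` (coarse) and A3 ✓`Prop7OneFormAgmon.exists_smulBond` (fine); the phase
row by px12 g13 ✓`exists_blockDistanceWeight` (i′) ∕ A4b's `φ_v`; nothing eventual; no hypothesis restates a conclusion.

References: T. Bałaban, CMP **99** (1985) 389–434 [Balaban1985BackgroundPropagators] ((3.13)–(3.16) p.393, Thm 3.1 (3.46) p.398, (3.49) p.399, (3.132) p.422); CMP **102** (1985) 277–309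
[Balaban1985Variational] ((44)–(45) p.285); S. Agmon, *Lectures on exponential decay of solutions of second-order elliptic equations* (Princeton 1982) Ch. 1 [Agmon1982]; J.-M. Combes,
L. Thomas, CMP **34** (1973) 251–270 [folklore].
-/

set_option autoImplicit false

noncomputable section

open scoped BigOperators Matrix.Norms.L2Operator InnerProductSpace ComplexConjugate

namespace Summit.QuantumFields.YangMills.Theorems.Prop7QkWeightConjugation

open Literature.MathematicalPhysics.QuantumFieldTheory.Balaban1983to89
open Literature.MathematicalPhysics.QuantumFieldTheory.Balaban1983to89.T3ContinuumYM3Torus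
open T3SectALandauChart (eta eta_pos)
open T3PrintedRegularMinimiser (RegPr)
open T3PrintedRegularOrbits (sites_eq)
open T3LevelShift (bondShift)
open B9Eq311L2Pairing (WL2)
open B11Eq103H1Complex (BondL2K)
open B5Eq118OneStroke (iterBlockOf)
open Summit.QuantumFields.YangMills.Theorems.Prop7SectET3Transport (periodsT3)
open Summit.QuantumFields.YangMills.Theorems.Prop7SectET3HilbertLetters (W₂ frobEquiv toL2 toL2B inner_toL2 inner_toL2B)
open Summit.QuantumFields.YangMills.Theorems.Prop7SectET3CurvedPropagators (Qk)
open Summit.QuantumFields.YangMills.Theorems.Prop7SymAvgTwSym (QTwS)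
open Summit.QuantumFields.YangMills.Theorems.Prop7TransverseRowOfTubeRowRegPr (Qk_toL2)
open Summit.QuantumFields.YangMills.Theorems.Prop7EngOfTrueAvgBudget (norm_toL2B_sq)
open Summit.QuantumFields.YangMills.Theorems.Prop7LaplaceAFlatLetters (norm_sq_toL2)
open Summit.QuantumFields.YangMills.Theorems.Prop7RieszTauFrobNorm (norm_sq_frobEquiv_symm)
open Summit.QuantumFields.YangMills.Theorems.Prop7BlockDistanceWeights (eta_mul_pow_eq_one)
open Summit.QuantumFields.YangMills.Theorems.Prop7OneFormAgmonAveraging (Qk_toL2_smul_eq_ref sum_normSq_entries_QTwS_relComm_le)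
open Summit.QuantumFields.YangMills.Theorems.Prop7OneFormAgmonWeights (readSet_ratio_exp_le)
open Summit.QuantumFields.YangMills.Theorems.Prop7OneFormAgmonPhaseClass (iterBlockOf_src_corner)
open Summit.QuantumFields.YangMills.Theorems.Prop7QkAdjointSupRowOfRegPr (norm_Qk_le_of_regPr)

/-! ## §1 Abstract: an operator bound passes to the adjoint -/

section Abstract

variable {V C : Type*} [NormedAddCommGroup V] [InnerProductSpace ℂ V] [NormedAddCommGroup C] [InnerProductSpace ℂ C]

/-- ★ **AN OPERATOR BOUND PASSES TO THE ADJOINT**: if `⟪Tx, c⟫ = ⟪x, Sc⟫` for all `x, c` and `‖Tx‖ ≤ δ‖x‖` (`0 ≤ δ`), then `‖Sc‖ ≤ δ‖c‖` (test `x := Sc`, Cauchy–Schwarz). [folklore] -/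
theorem norm_le_of_adjoint_pair (T : V →ₗ[ℂ] C) (S : C →ₗ[ℂ] V) (hTS : ∀ (x : V) (c : C), ⟪T x, c⟫_ℂ = ⟪x, S c⟫_ℂ)
    {δ : ℝ} (hδ : 0 ≤ δ) (hT : ∀ x, ‖T x‖ ≤ δ * ‖x‖) (c : C) : ‖S c‖ ≤ δ * ‖c‖ := by
  have h1 : ‖S c‖ ^ 2 = RCLike.re ⟪T (S c), c⟫_ℂ := by
    rw [hTS, ← inner_self_eq_norm_sq (𝕜 := ℂ)]
  have h2 : ‖S c‖ ^ 2 ≤ δ * ‖S c‖ * ‖c‖ := by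
    rw [h1]
    exact ((RCLike.re_le_norm _).trans (norm_inner_le_norm _ _)).trans (mul_le_mul_of_nonneg_right (hT _) (norm_nonneg _))
  by_cases h0 : ‖S c‖ = 0
  · rw [h0]; positivity
  · have hpos : 0 < ‖S c‖ := lt_of_le_of_ne (norm_nonneg _) (Ne.symm h0)
    have h3 : ‖S c‖ * ‖S c‖ ≤ δ * ‖c‖ * ‖S c‖ := by nlinarith
    exact le_of_mul_le_mul_right h3 hpos

end Abstract

/-! ## §2 Multiplication operators by real weights on the two carriers, described by their action on `toL2B Z` ∕ `toL2 X` -/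

section Weights

variable {F : T3Family} {n K : ℕ} {c₀ cB : ℝ} [Fact (0 < c₀)] [Fact (0 < cB)]

omit [Fact (0 < c₀)] [Fact (0 < cB)] in
/-- **THE COARSE MULTIPLIER `M_w`, ∃-PACKAGED**: a linear map on the block carrier with `M_w(toL2B Z) = toL2B(y ↦ w(y)•Z(y))` for a real block function `w`.
[cite: Balaban1985BackgroundPropagators, (3.16) p.393] -/
theorem exists_weightOpB (w : PBond (F.P n) 0 → ℝ) :
    ∃ M : WL2 ℂ (fun _ : PBond (F.P n) 0 => cB) W₂ →ₗ[ℂ] WL2 ℂ (fun _ : PBond (F.P n) 0 => cB) W₂,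
      ∀ Z : PBond (F.P n) 0 → Matrix (Fin 2) (Fin 2) ℂ, M (toL2B F n cB Z) = toL2B F n cB (fun y => w y • Z y) := by
  refine ⟨(toL2B F n cB).toLinearMap ∘ₗ (LinearMap.pi fun y : PBond (F.P n) 0 => ((w y : ℝ) : ℂ) • LinearMap.proj y) ∘ₗ (toL2B F n cB).symm.toLinearMap, fun Z => ?_⟩
  have e : (LinearMap.pi fun y : PBond (F.P n) 0 => ((w y : ℝ) : ℂ) • LinearMap.proj (R := ℂ) (φ := fun _ : PBond (F.P n) 0 => Matrix (Fin 2) (Fin 2) ℂ) y) Z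
      = fun y => w y • Z y := by
    funext y
    rw [LinearMap.pi_apply, LinearMap.smul_apply, LinearMap.proj_apply, Complex.coe_smul]
  rw [LinearMap.comp_apply, LinearMap.comp_apply, LinearEquiv.coe_toLinearMap, LinearEquiv.coe_toLinearMap, LinearEquiv.symm_apply_apply, e]

omit [Fact (0 < c₀)] [Fact (0 < cB)] in
/-- **TWO COARSE MULTIPLIERS WITH `w₂·w₁ = 1` COMPOSE TO THE IDENTITY** (`M_i(Mg) = g`, `M(M_ig) = g` for `w`, `w⁻¹`). [folklore] -/
theorem weightB_comp_apply (w₁ w₂ : PBond (F.P n) 0 → ℝ) (h12 : ∀ y, w₂ y * w₁ y = 1)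
    (M₁ M₂ : WL2 ℂ (fun _ : PBond (F.P n) 0 => cB) W₂ →ₗ[ℂ] WL2 ℂ (fun _ : PBond (F.P n) 0 => cB) W₂)
    (hM₁ : ∀ Z, M₁ (toL2B F n cB Z) = toL2B F n cB (fun y => w₁ y • Z y)) (hM₂ : ∀ Z, M₂ (toL2B F n cB Z) = toL2B F n cB (fun y => w₂ y • Z y))
    (g : WL2 ℂ (fun _ : PBond (F.P n) 0 => cB) W₂) : M₂ (M₁ g) = g := by
  obtain ⟨Z, rfl⟩ : ∃ Z, g = toL2B F n cB Z := ⟨(toL2B F n cB).symm g, ((toL2B F n cB).apply_symm_apply g).symm⟩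
  rw [hM₁, hM₂]
  congr 1
  funext y
  rw [smul_smul, h12, one_smul]

omit [Fact (0 < c₀)] in
/-- ★ **A REAL COARSE MULTIPLIER IS SYMMETRIC**: `⟪Mg, g′⟫ = ⟪g, Mg′⟫` (the block pairing (3.16) with a real scalar per block). [cite: Balaban1985BackgroundPropagators, (3.16) p.393] -/
theorem inner_weightB_comm (w : PBond (F.P n) 0 → ℝ) (M : WL2 ℂ (fun _ : PBond (F.P n) 0 => cB) W₂ →ₗ[ℂ] WL2 ℂ (fun _ : PBond (F.P n) 0 => cB) W₂)
    (hM : ∀ Z, M (toL2B F n cB Z) = toL2B F n cB (fun y => w y • Z y)) (g g' : WL2 ℂ (fun _ : PBond (F.P n) 0 => cB) W₂) :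
    ⟪M g, g'⟫_ℂ = ⟪g, M g'⟫_ℂ := by
  obtain ⟨Z, rfl⟩ : ∃ Z, g = toL2B F n cB Z := ⟨(toL2B F n cB).symm g, ((toL2B F n cB).apply_symm_apply g).symm⟩
  obtain ⟨Z', rfl⟩ : ∃ Z', g' = toL2B F n cB Z' := ⟨(toL2B F n cB).symm g', ((toL2B F n cB).apply_symm_apply g').symm⟩
  rw [hM, hM, inner_toL2B, inner_toL2B]
  congr 1
  refine Finset.sum_congr rfl fun y _ => ?_
  rw [← Complex.coe_smul, ← Complex.coe_smul, Matrix.conjTranspose_smul, Matrix.smul_mul, Matrix.mul_smul, Complex.star_def, Complex.conj_ofReal]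

omit [Fact (0 < c₀)] [Fact (0 < cB)] in
/-- **TWO FINE MULTIPLIERS WITH `ω₂·ω₁ = 1` COMPOSE TO THE IDENTITY** (`M_fi(M_f x) = x`, `M_f(M_fi x) = x`). [folklore] -/
theorem weight_comp_apply (ω₁ ω₂ : PBond (F.P K) 0 → ℝ) (h12 : ∀ b, ω₂ b * ω₁ b = 1)
    (M₁ M₂ : BondL2K ℂ 3 (periodsT3 F K) c₀ W₂ →ₗ[ℂ] BondL2K ℂ 3 (periodsT3 F K) c₀ W₂)
    (hM₁ : ∀ X, M₁ (toL2 F K c₀ X) = toL2 F K c₀ (fun b => ω₁ b • X b)) (hM₂ : ∀ X, M₂ (toL2 F K c₀ X) = toL2 F K c₀ (fun b => ω₂ b • X b))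
    (x : BondL2K ℂ 3 (periodsT3 F K) c₀ W₂) : M₂ (M₁ x) = x := by
  obtain ⟨X, rfl⟩ : ∃ X, x = toL2 F K c₀ X := ⟨(toL2 F K c₀).symm x, ((toL2 F K c₀).apply_symm_apply x).symm⟩
  rw [hM₁, hM₂]
  congr 1
  funext b
  rw [smul_smul, h12, one_smul]

omit [Fact (0 < cB)] in
/-- ★ **A REAL FINE MULTIPLIER IS SYMMETRIC**: `⟪Mx, x′⟫ = ⟪x, Mx′⟫` (the pairing (3.11) with a real scalar per bond). [cite: Balaban1985BackgroundPropagators, (3.11) p.392] -/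
theorem inner_weight_comm (ω : PBond (F.P K) 0 → ℝ) (M : BondL2K ℂ 3 (periodsT3 F K) c₀ W₂ →ₗ[ℂ] BondL2K ℂ 3 (periodsT3 F K) c₀ W₂)
    (hM : ∀ X, M (toL2 F K c₀ X) = toL2 F K c₀ (fun b => ω b • X b)) (x x' : BondL2K ℂ 3 (periodsT3 F K) c₀ W₂) :
    ⟪M x, x'⟫_ℂ = ⟪x, M x'⟫_ℂ := by
  obtain ⟨X, rfl⟩ : ∃ X, x = toL2 F K c₀ X := ⟨(toL2 F K c₀).symm x, ((toL2 F K c₀).apply_symm_apply x).symm⟩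
  obtain ⟨X', rfl⟩ : ∃ X', x' = toL2 F K c₀ X' := ⟨(toL2 F K c₀).symm x', ((toL2 F K c₀).apply_symm_apply x').symm⟩
  rw [hM, hM, inner_toL2, inner_toL2]
  congr 1
  refine Finset.sum_congr rfl fun b _ => ?_
  rw [← Complex.coe_smul, ← Complex.coe_smul, Matrix.conjTranspose_smul, Matrix.smul_mul, Matrix.mul_smul, Complex.star_def, Complex.conj_ofReal]

variable (F) (h : n ≤ K) (c₀ cB)

/-- **THE `hQadj` ROW: `‖Q_k(U₀)† c‖ ≤ 6√(cB∕c₀)·√(ℓ⁻³)·‖c‖`** at a printed-regular background (px17 ✓`norm_Qk_le_of_regPr` passed to the adjoint by §1; K-FREE `= 6` at the pin `cB = c₀ℓ³`).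
[cite: Balaban1985BackgroundPropagators, (3.14)–(3.16) p.393] -/
theorem norm_adjoint_Qk_le_of_regPr {ε₀ : ℝ} (hε₀ : 0 < ε₀) (hε : 10 ^ 10 * (F.L : ℝ) ^ 6 * ε₀ ≤ 1) (hε12 : 10 ^ 12 * (F.L : ℝ) ^ 3 * ε₀ ≤ 1)
    (U₀ : GaugeField (F.P K) 0 (Matrix.specialUnitaryGroup (Fin 2) ℂ)) (hreg : RegPr F n K ε₀ U₀) (c : WL2 ℂ (fun _ : PBond (F.P n) 0 => cB) W₂) :
    ‖LinearMap.adjoint (Qk F n K h c₀ cB U₀) c‖ ≤ 6 * Real.sqrt (cB / c₀) * Real.sqrt (((F.L : ℝ) ^ (K - n))⁻¹ ^ 3) * ‖c‖ :=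
  norm_le_of_adjoint_pair (Qk F n K h c₀ cB U₀) (LinearMap.adjoint (Qk F n K h c₀ cB U₀)) (fun x c => (LinearMap.adjoint_inner_right _ x c).symm)
    (by positivity) (norm_Qk_le_of_regPr F h c₀ cB hε₀ hε hε12 U₀ hreg) c

end Weights

/-! ## §3 The relative commutator of `Q_k` with a weight pair, in operator norm -/

section RelComm

variable (F : T3Family) {n K : ℕ} (h : n ≤ K) (c₀ cB : ℝ) [Fact (0 < c₀)] [Fact (0 < cB)]

/-- **THE `L²` SIZE OF THE RELATIVE-COMMUTATOR VECTOR `η•toL2B E`** from A2b's carrier row `Σ_ĉ|E ĉ|² ≤ 216ρ_Q²(ℓ²∕ℓ^d)Σ_b|X b|²`: `‖η•toL2B E‖ ≤ √(216ρ_Q²(cB∕(c₀ℓ³)))·‖toL2 X‖`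
(`η²ℓ² = 1` eats the averaging scale; the arithmetic of A2b ✓`abs_re_inner_Qk_conj_sub_le`). [cite: Balaban1985BackgroundPropagators, (3.13)–(3.16) p.393] -/
theorem norm_eta_smul_toL2B_le {ρQ : ℝ} (Ef : PBond (F.P n) 0 → Matrix (Fin 2) (Fin 2) ℂ) (X : PBond (F.P K) 0 → Matrix (Fin 2) (Fin 2) ℂ)
    (hEf : ∑ bc : PBond (F.P n) 0, ∑ j, ∑ k, ‖Ef bc j k‖ ^ 2
      ≤ 216 * ρQ ^ 2 * (((F.L : ℝ) ^ (K - n)) ^ 2 / ((F.L : ℝ) ^ (K - n)) ^ (F.P K).d) * ∑ b : PBond (F.P K) 0, ∑ j, ∑ k, ‖X b j k‖ ^ 2) :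
    ‖((eta F n K : ℝ) : ℂ) • toL2B F n cB Ef‖ ≤ Real.sqrt (216 * ρQ ^ 2 * (cB / (c₀ * ((F.L : ℝ) ^ (K - n)) ^ 3))) * ‖toL2 F K c₀ X‖ := by
  have hc₀ : 0 < c₀ := Fact.out
  have hcB : 0 < cB := Fact.out
  have hη : 0 < eta F n K := eta_pos F n K
  have hL0 : (0 : ℝ) < F.L := by exact_mod_cast lt_trans zero_lt_one F.hL.2
  have hℓ : (0 : ℝ) < (F.L : ℝ) ^ (K - n) := pow_pos hL0 _
  have hd : (F.P K).d = 3 := T3Family.P_d F K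
  set κ2 : ℝ := 216 * ρQ ^ 2 * (cB / (c₀ * ((F.L : ℝ) ^ (K - n)) ^ 3)) with hκ2
  have hκ2_0 : 0 ≤ κ2 := by positivity
  have hX : ‖toL2 F K c₀ X‖ ^ 2 = c₀ * ∑ b : PBond (F.P K) 0, ∑ j, ∑ k, ‖X b j k‖ ^ 2 := norm_sq_toL2 X
  have hηℓ : eta F n K ^ 2 * (((F.L : ℝ) ^ (K - n)) ^ 2 / ((F.L : ℝ) ^ (K - n)) ^ (F.P K).d) = (((F.L : ℝ) ^ (K - n)) ^ 3)⁻¹ := by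
    rw [hd]
    have e1 := eta_mul_pow_eq_one F (n := n) (K := K)
    field_simp
    nlinarith [e1]
  have hsq : ‖((eta F n K : ℝ) : ℂ) • toL2B F n cB Ef‖ ^ 2 ≤ (Real.sqrt κ2 * ‖toL2 F K c₀ X‖) ^ 2 := by
    rw [norm_smul, mul_pow, Complex.norm_real, Real.norm_of_nonneg hη.le, norm_toL2B_sq, mul_pow, Real.sq_sqrt hκ2_0, hX, hκ2]
    rw [Finset.sum_congr rfl fun c _ => norm_sq_frobEquiv_symm (Ef c)]
    calc eta F n K ^ 2 * (cB * ∑ c : PBond (F.P n) 0, ∑ j, ∑ k, ‖Ef c j k‖ ^ 2)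
        ≤ eta F n K ^ 2 * (cB * (216 * ρQ ^ 2 * (((F.L : ℝ) ^ (K - n)) ^ 2 / ((F.L : ℝ) ^ (K - n)) ^ (F.P K).d) * ∑ b : PBond (F.P K) 0, ∑ j, ∑ k, ‖X b j k‖ ^ 2)) :=
          mul_le_mul_of_nonneg_left (mul_le_mul_of_nonneg_left hEf hcB.le) (sq_nonneg _)
      _ = 216 * ρQ ^ 2 * (cB / (c₀ * ((F.L : ℝ) ^ (K - n)) ^ 3)) * (c₀ * ∑ b : PBond (F.P K) 0, ∑ j, ∑ k, ‖X b j k‖ ^ 2) := by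
          have e2 : cB / (c₀ * ((F.L : ℝ) ^ (K - n)) ^ 3) = cB * (((F.L : ℝ) ^ (K - n)) ^ 3)⁻¹ / c₀ := by
            field_simp
          rw [e2, ← hηℓ]; field_simp
  exact (pow_le_pow_iff_left₀ (norm_nonneg _) (by positivity) two_ne_zero).1 hsq

omit [Fact (0 < c₀)] [Fact (0 < cB)] in
/-- ★ **THE CONJUGATED AVERAGING OPERATOR MINUS THE AVERAGING OPERATOR IS THE RELATIVE COMMUTATOR**: for a real site weight `v` (`v(x_r ĉ) ≠ 0`), a fine multiplier `A ↔ v(b₋)` and a coarse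
multiplier `B ↔ w_c` with `w_c(ĉ)·v(x_r ĉ) = 1`: `B(Q_k(A(toL2 X))) − Q_k(toL2 X) = η•toL2B(ĉ ↦ QTwS((v(b₋)∕v(x_r ĉ) − 1)·X) ĉ)` (A2b ✓`Qk_toL2_smul_eq_ref`).
[cite: Balaban1985BackgroundPropagators, (3.14)–(3.16) p.393] -/
theorem weight_Qk_weight_sub_eq (U₀ : GaugeField (F.P K) 0 (Matrix.specialUnitaryGroup (Fin 2) ℂ)) (v : Site (F.P K) 0 → ℝ)
    (xr : PBond (F.P n) 0 → Site (F.P K) 0) (hxr : ∀ c, v (xr c) ≠ 0) (wc : PBond (F.P n) 0 → ℝ) (hrel : ∀ c, wc c * v (xr c) = 1)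
    (A : BondL2K ℂ 3 (periodsT3 F K) c₀ W₂ →ₗ[ℂ] BondL2K ℂ 3 (periodsT3 F K) c₀ W₂) (hA : ∀ X, A (toL2 F K c₀ X) = toL2 F K c₀ (fun b => v b.src • X b))
    (B : WL2 ℂ (fun _ : PBond (F.P n) 0 => cB) W₂ →ₗ[ℂ] WL2 ℂ (fun _ : PBond (F.P n) 0 => cB) W₂) (hB : ∀ Z, B (toL2B F n cB Z) = toL2B F n cB (fun y => wc y • Z y))
    (X : PBond (F.P K) 0 → Matrix (Fin 2) (Fin 2) ℂ) :
    B (Qk F n K h c₀ cB U₀ (A (toL2 F K c₀ X))) - Qk F n K h c₀ cB U₀ (toL2 F K c₀ X)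
      = ((eta F n K : ℝ) : ℂ) • toL2B F n cB (fun c => QTwS F n K h U₀ (fun b : PBond (F.P K) 0 => (((v b.src / v (xr c) - 1 : ℝ)) : ℂ) • X b) c) := by
  set G : PBond (F.P n) 0 → Matrix (Fin 2) (Fin 2) ℂ := QTwS F n K h U₀ X with hG
  set E : PBond (F.P n) 0 → Matrix (Fin 2) (Fin 2) ℂ := fun c =>
    QTwS F n K h U₀ (fun b : PBond (F.P K) 0 => (((v b.src / v (xr c) - 1 : ℝ)) : ℂ) • X b) c with hE
  have h1 : Qk F n K h c₀ cB U₀ (A (toL2 F K c₀ X)) = toL2B F n cB (fun c => v (xr c) • (((eta F n K : ℝ) : ℂ) • (G c + E c))) := by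
    rw [hA]; exact Qk_toL2_smul_eq_ref F h c₀ cB U₀ v xr hxr X
  have h2 : B (toL2B F n cB (fun c => v (xr c) • (((eta F n K : ℝ) : ℂ) • (G c + E c)))) = ((eta F n K : ℝ) : ℂ) • toL2B F n cB (G + E) := by
    rw [hB, ← map_smul]
    congr 1
    funext c
    simp only [Pi.smul_apply, Pi.add_apply]
    rw [smul_smul, hrel, one_smul]
  rw [h1, h2, Qk_toL2, ← hG, map_add, smul_add, add_sub_cancel_left]

/-- ★★ **THE `Q_k` WEIGHT-CONJUGATION LETTER IN OPERATOR NORM**: `RegPr F n K ε₀ U₀`, `10¹⁰L⁶ε₀ ≤ 1`, `10¹²L³ε₀ ≤ 1`; a positive site weight `v` with the read-set ratio row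
`|v(b₋)∕v(x_r ĉ) − 1| ≤ ρ_Q` (fine bonds sourced in `ĉ₋ ∪ ĉ₊`); a fine multiplier `A ↔ v(b₋)` and a coarse multiplier `B ↔ w_c`, `w_c(ĉ)·v(x_r ĉ) = 1`.  THEN for every `x`:
`‖B(Q_k(Ax)) − Q_k x‖ ≤ √(216ρ_Q²(cB∕(c₀ℓ³)))·‖x‖`. [cite: Balaban1985BackgroundPropagators, (3.13)–(3.16) p.393, Thm 3.1 (3.46) p.398, (3.132) p.422] -/
theorem norm_weight_Qk_weight_sub_le {ε₀ : ℝ} (hε₀ : 0 < ε₀) (hε : 10 ^ 10 * (F.L : ℝ) ^ 6 * ε₀ ≤ 1) (hε12 : 10 ^ 12 * (F.L : ℝ) ^ 3 * ε₀ ≤ 1)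
    (U₀ : GaugeField (F.P K) 0 (Matrix.specialUnitaryGroup (Fin 2) ℂ)) (hreg : RegPr F n K ε₀ U₀)
    (v : Site (F.P K) 0 → ℝ) (hv : ∀ x, 0 < v x) (xr : PBond (F.P n) 0 → Site (F.P K) 0) {ρQ : ℝ}
    (hρQ : ∀ (c : PBond (F.P n) 0) (b : PBond (F.P K) 0),
      (iterBlockOf (K - n) b.src = (bondShift (sites_eq F n K h) c).src ∨ iterBlockOf (K - n) b.src = (bondShift (sites_eq F n K h) c).tgt) →
      |v b.src / v (xr c) - 1| ≤ ρQ)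
    (wc : PBond (F.P n) 0 → ℝ) (hrel : ∀ c, wc c * v (xr c) = 1)
    (A : BondL2K ℂ 3 (periodsT3 F K) c₀ W₂ →ₗ[ℂ] BondL2K ℂ 3 (periodsT3 F K) c₀ W₂) (hA : ∀ X, A (toL2 F K c₀ X) = toL2 F K c₀ (fun b => v b.src • X b))
    (B : WL2 ℂ (fun _ : PBond (F.P n) 0 => cB) W₂ →ₗ[ℂ] WL2 ℂ (fun _ : PBond (F.P n) 0 => cB) W₂) (hB : ∀ Z, B (toL2B F n cB Z) = toL2B F n cB (fun y => wc y • Z y))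
    (x : BondL2K ℂ 3 (periodsT3 F K) c₀ W₂) :
    ‖B (Qk F n K h c₀ cB U₀ (A x)) - Qk F n K h c₀ cB U₀ x‖ ≤ Real.sqrt (216 * ρQ ^ 2 * (cB / (c₀ * ((F.L : ℝ) ^ (K - n)) ^ 3))) * ‖x‖ := by
  obtain ⟨X, rfl⟩ : ∃ X, x = toL2 F K c₀ X := ⟨(toL2 F K c₀).symm x, ((toL2 F K c₀).apply_symm_apply x).symm⟩
  rw [weight_Qk_weight_sub_eq F h c₀ cB U₀ v xr (fun c => (hv _).ne') wc hrel A hA B hB X]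
  exact norm_eta_smul_toL2B_le F c₀ cB _ X (sum_normSq_entries_QTwS_relComm_le F n K h hε₀ hε hε12 U₀ hreg v xr hρQ X)

end RelComm

/-! ## §4 ★★★ The two letters `hA`, `hC` of ✓`conj_accretive_of_letters` for one positive weight, and the exponential editions -/

section Letters

variable (F : T3Family) {n K : ℕ} (h : n ≤ K) (c₀ cB : ℝ) [Fact (0 < c₀)] [Fact (0 < cB)]

/-- ★★★ **THE `Q_k` WEIGHT-CONJUGATION LETTERS `hA` ∕ `hC` OF ✓p767718 `Prop7KinvConjugateDecay.conj_accretive_of_letters`, DISCHARGED AT A PRINTED-REGULAR BACKGROUND.**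
`RegPr F n K ε₀ U₀`, `10¹⁰L⁶ε₀ ≤ 1`, `10¹²L³ε₀ ≤ 1`; a positive site weight `w` and reference sites `x_r(ĉ)` with BOTH read-set ratios `|w(b₋)∕w(x_r ĉ) − 1|, |w(x_r ĉ)∕w(b₋) − 1| ≤ ρ_Q`
(fine bonds sourced in `ĉ₋ ∪ ĉ₊`); linear maps `M ↔ w(x_r ĉ)`, `M_i ↔ w(x_r ĉ)⁻¹` on the block carrier and `M_f ↔ w(b₋)`, `M_fi ↔ w(b₋)⁻¹` on the fine carrier (rows `hM`, `hMi`, `hMf`, `hMfi`).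
THEN with `δ := √(216ρ_Q²(cB∕(c₀ℓ³)))`: **(hA) `∀ x, ‖M(Q_k(M_fi x)) − Q_k x‖ ≤ δ‖x‖`** and **(hC) `∀ c, ‖M_f(Q_k†(M_i c)) − Q_k† c‖ ≤ δ‖c‖`** (`Q_k† := LinearMap.adjoint (Qk U₀)`; (hC) = (hA) for
the reciprocal pair by `⟪·,·⟫`-duality, §1 + §2's symmetry). [cite: Balaban1985BackgroundPropagators, (3.13)–(3.16) p.393, Thm 3.1 (3.46) p.398, (3.132) p.422; Agmon1982, Ch. 1] -/
theorem qkWeightConj_letters_of_regPr {ε₀ : ℝ} (hε₀ : 0 < ε₀) (hε : 10 ^ 10 * (F.L : ℝ) ^ 6 * ε₀ ≤ 1) (hε12 : 10 ^ 12 * (F.L : ℝ) ^ 3 * ε₀ ≤ 1)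
    (U₀ : GaugeField (F.P K) 0 (Matrix.specialUnitaryGroup (Fin 2) ℂ)) (hreg : RegPr F n K ε₀ U₀)
    (w : Site (F.P K) 0 → ℝ) (hw : ∀ x, 0 < w x) (xr : PBond (F.P n) 0 → Site (F.P K) 0) {ρQ : ℝ}
    (hρQ : ∀ (c : PBond (F.P n) 0) (b : PBond (F.P K) 0),
      (iterBlockOf (K - n) b.src = (bondShift (sites_eq F n K h) c).src ∨ iterBlockOf (K - n) b.src = (bondShift (sites_eq F n K h) c).tgt) →
      |w b.src / w (xr c) - 1| ≤ ρQ ∧ |w (xr c) / w b.src - 1| ≤ ρQ)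
    (M Mi : WL2 ℂ (fun _ : PBond (F.P n) 0 => cB) W₂ →ₗ[ℂ] WL2 ℂ (fun _ : PBond (F.P n) 0 => cB) W₂)
    (hM : ∀ Z, M (toL2B F n cB Z) = toL2B F n cB (fun y => w (xr y) • Z y)) (hMi : ∀ Z, Mi (toL2B F n cB Z) = toL2B F n cB (fun y => (w (xr y))⁻¹ • Z y))
    (Mf Mfi : BondL2K ℂ 3 (periodsT3 F K) c₀ W₂ →ₗ[ℂ] BondL2K ℂ 3 (periodsT3 F K) c₀ W₂)
    (hMf : ∀ X, Mf (toL2 F K c₀ X) = toL2 F K c₀ (fun b => w b.src • X b)) (hMfi : ∀ X, Mfi (toL2 F K c₀ X) = toL2 F K c₀ (fun b => (w b.src)⁻¹ • X b)) :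
    (∀ x, ‖M (Qk F n K h c₀ cB U₀ (Mfi x)) - Qk F n K h c₀ cB U₀ x‖ ≤ Real.sqrt (216 * ρQ ^ 2 * (cB / (c₀ * ((F.L : ℝ) ^ (K - n)) ^ 3))) * ‖x‖) ∧
    (∀ c, ‖Mf (LinearMap.adjoint (Qk F n K h c₀ cB U₀) (Mi c)) - LinearMap.adjoint (Qk F n K h c₀ cB U₀) c‖
        ≤ Real.sqrt (216 * ρQ ^ 2 * (cB / (c₀ * ((F.L : ℝ) ^ (K - n)) ^ 3))) * ‖c‖) := by
  have hw0 : ∀ x, w x ≠ 0 := fun x => (hw x).ne'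
  refine ⟨fun x => ?_, fun c => ?_⟩
  · -- (hA): the core letter at the reciprocal site weight `w⁻¹` (fine `(w b₋)⁻¹`, coarse `w(x_r ĉ)`)
    refine norm_weight_Qk_weight_sub_le F h c₀ cB hε₀ hε hε12 U₀ hreg (fun x => (w x)⁻¹) (fun x => inv_pos.mpr (hw x)) xr (ρQ := ρQ)
      (fun c b hb => ?_) (fun y => w (xr y)) (fun c => mul_inv_cancel₀ (hw0 _)) Mfi hMfi M hM x
    simp only [inv_div_inv]
    exact (hρQ c b hb).2
  · -- (hC): duality from the letter for `M_i ∘ Q_k ∘ M_f − Q_k` (the core letter at `w`: fine `w(b₋)`, coarse `w(x_r ĉ)⁻¹`)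
    have hT : ∀ x, ‖(Mi ∘ₗ Qk F n K h c₀ cB U₀ ∘ₗ Mf - Qk F n K h c₀ cB U₀) x‖ ≤ Real.sqrt (216 * ρQ ^ 2 * (cB / (c₀ * ((F.L : ℝ) ^ (K - n)) ^ 3))) * ‖x‖ := fun x => by
      simp only [LinearMap.sub_apply, LinearMap.comp_apply]
      exact norm_weight_Qk_weight_sub_le F h c₀ cB hε₀ hε hε12 U₀ hreg w hw xr (ρQ := ρQ) (fun c b hb => (hρQ c b hb).1)
        (fun y => (w (xr y))⁻¹) (fun c => inv_mul_cancel₀ (hw0 _)) Mf hMf Mi hMi x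
    have hTS : ∀ (x : BondL2K ℂ 3 (periodsT3 F K) c₀ W₂) (c : WL2 ℂ (fun _ : PBond (F.P n) 0 => cB) W₂),
        ⟪(Mi ∘ₗ Qk F n K h c₀ cB U₀ ∘ₗ Mf - Qk F n K h c₀ cB U₀) x, c⟫_ℂ
          = ⟪x, (Mf ∘ₗ LinearMap.adjoint (Qk F n K h c₀ cB U₀) ∘ₗ Mi - LinearMap.adjoint (Qk F n K h c₀ cB U₀)) c⟫_ℂ := fun x c => by
      simp only [LinearMap.sub_apply, LinearMap.comp_apply, inner_sub_left, inner_sub_right]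
      rw [inner_weightB_comm (fun y => (w (xr y))⁻¹) Mi hMi, ← LinearMap.adjoint_inner_right (Qk F n K h c₀ cB U₀) (Mf x),
        inner_weight_comm (fun b : PBond (F.P K) 0 => w b.src) Mf hMf, ← LinearMap.adjoint_inner_right (Qk F n K h c₀ cB U₀) x]
    have h := norm_le_of_adjoint_pair _ _ hTS (Real.sqrt_nonneg _) hT c
    simpa only [LinearMap.sub_apply, LinearMap.comp_apply] using h

/-- ★★★ **THE EXPONENTIAL EDITION**: `RegPr F n K ε₀ U₀` + routeR-w4's windows; a phase `φ` with the fine-Lipschitz row `|φ x − φ x′| ≤ r·η·tdist x x′` (`0 ≤ r`; px12 g13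
✓`exists_blockDistanceWeight` (i′), A4b's `φ_v`), reference sites `x_r(ĉ)` IN THE SOURCE BLOCKS; the four operators `M ↔ e^{φ(x_r ĉ)}`, `M_i ↔ e^{−φ(x_r ĉ)}`, `M_f ↔ e^{φ(b₋)}`, `M_fi ↔ e^{−φ(b₋)}`
(rows spelled with `Real.exp (φ ·)` and `(Real.exp (φ ·))⁻¹`).  THEN (hA) and (hC) hold with **`δ = √(216·(e^{r(d+1)} − 1)²·(cB∕(c₀ℓ³)))`** (A2e ✓`readSet_ratio_exp_le`) — K-FREE at `cB = c₀ℓ³`, `→ 0`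
as `r → 0`. [cite: Balaban1985BackgroundPropagators, (3.13)–(3.16) p.393, Thm 3.1 (3.46) p.398, (3.49) p.399, (3.132) p.422; Agmon1982, Ch. 1] -/
theorem qkWeightConj_letters_exp_of_regPr {ε₀ : ℝ} (hε₀ : 0 < ε₀) (hε : 10 ^ 10 * (F.L : ℝ) ^ 6 * ε₀ ≤ 1) (hε12 : 10 ^ 12 * (F.L : ℝ) ^ 3 * ε₀ ≤ 1)
    (U₀ : GaugeField (F.P K) 0 (Matrix.specialUnitaryGroup (Fin 2) ℂ)) (hreg : RegPr F n K ε₀ U₀)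
    (φ : Site (F.P K) 0 → ℝ) {r : ℝ} (hr : 0 ≤ r) (hφ' : ∀ x x' : Site (F.P K) 0, |φ x - φ x'| ≤ r * eta F n K * (Site.tdist x x' : ℝ))
    (xr : PBond (F.P n) 0 → Site (F.P K) 0) (hxr : ∀ c, iterBlockOf (K - n) (xr c) = (bondShift (sites_eq F n K h) c).src)
    (M Mi : WL2 ℂ (fun _ : PBond (F.P n) 0 => cB) W₂ →ₗ[ℂ] WL2 ℂ (fun _ : PBond (F.P n) 0 => cB) W₂)
    (hM : ∀ Z, M (toL2B F n cB Z) = toL2B F n cB (fun y => Real.exp (φ (xr y)) • Z y))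
    (hMi : ∀ Z, Mi (toL2B F n cB Z) = toL2B F n cB (fun y => (Real.exp (φ (xr y)))⁻¹ • Z y))
    (Mf Mfi : BondL2K ℂ 3 (periodsT3 F K) c₀ W₂ →ₗ[ℂ] BondL2K ℂ 3 (periodsT3 F K) c₀ W₂)
    (hMf : ∀ X, Mf (toL2 F K c₀ X) = toL2 F K c₀ (fun b => Real.exp (φ b.src) • X b))
    (hMfi : ∀ X, Mfi (toL2 F K c₀ X) = toL2 F K c₀ (fun b => (Real.exp (φ b.src))⁻¹ • X b)) :
    (∀ x, ‖M (Qk F n K h c₀ cB U₀ (Mfi x)) - Qk F n K h c₀ cB U₀ x‖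
        ≤ Real.sqrt (216 * (Real.exp (r * ((F.P K).d + 1)) - 1) ^ 2 * (cB / (c₀ * ((F.L : ℝ) ^ (K - n)) ^ 3))) * ‖x‖) ∧
    (∀ c, ‖Mf (LinearMap.adjoint (Qk F n K h c₀ cB U₀) (Mi c)) - LinearMap.adjoint (Qk F n K h c₀ cB U₀) c‖
        ≤ Real.sqrt (216 * (Real.exp (r * ((F.P K).d + 1)) - 1) ^ 2 * (cB / (c₀ * ((F.L : ℝ) ^ (K - n)) ^ 3))) * ‖c‖) :=
  qkWeightConj_letters_of_regPr F h c₀ cB hε₀ hε hε12 U₀ hreg (fun x => Real.exp (φ x)) (fun _ => Real.exp_pos _) xr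
    (fun c b hb => readSet_ratio_exp_le F h φ hr hφ' xr hxr c b hb) M Mi hM hMi Mf Mfi hMf hMfi

/-- ★★ **THE EXPONENTIAL EDITION AT THE BLOCK CORNERS** (reference sites := the corners of the source blocks, A2g ✓`iterBlockOf_src_corner` — the choice of A4b ∕ K2 ∕ E2E): (hA) and (hC) with
`δ = √(216·(e^{r(d+1)} − 1)²·(cB∕(c₀ℓ³)))` for the coarse phase `φ_c(ĉ) := φ(corner ĉ₋)`. [cite: Balaban1985BackgroundPropagators, (3.13)–(3.16) p.393, Thm 3.1 (3.46) p.398, (3.132) p.422; Balaban1985Averaging, (2) p.17] -/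
theorem qkWeightConj_letters_exp_corner_of_regPr {ε₀ : ℝ} (hε₀ : 0 < ε₀) (hε : 10 ^ 10 * (F.L : ℝ) ^ 6 * ε₀ ≤ 1) (hε12 : 10 ^ 12 * (F.L : ℝ) ^ 3 * ε₀ ≤ 1)
    (U₀ : GaugeField (F.P K) 0 (Matrix.specialUnitaryGroup (Fin 2) ℂ)) (hreg : RegPr F n K ε₀ U₀)
    (φ : Site (F.P K) 0 → ℝ) {r : ℝ} (hr : 0 ≤ r) (hφ' : ∀ x x' : Site (F.P K) 0, |φ x - φ x'| ≤ r * eta F n K * (Site.tdist x x' : ℝ))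
    (M Mi : WL2 ℂ (fun _ : PBond (F.P n) 0 => cB) W₂ →ₗ[ℂ] WL2 ℂ (fun _ : PBond (F.P n) 0 => cB) W₂)
    (hM : ∀ Z, M (toL2B F n cB Z) = toL2B F n cB (fun y => Real.exp (φ
      (Site.fibreSite 0 (K - n) (bondShift (sites_eq F n K h) y).src fun _ => (⟨0, pow_pos (F.P K).L_pos (K - n)⟩ : Fin ((F.P K).L ^ (K - n))))) • Z y))
    (hMi : ∀ Z, Mi (toL2B F n cB Z) = toL2B F n cB (fun y => (Real.exp (φ
      (Site.fibreSite 0 (K - n) (bondShift (sites_eq F n K h) y).src fun _ => (⟨0, pow_pos (F.P K).L_pos (K - n)⟩ : Fin ((F.P K).L ^ (K - n))))))⁻¹ • Z y))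
    (Mf Mfi : BondL2K ℂ 3 (periodsT3 F K) c₀ W₂ →ₗ[ℂ] BondL2K ℂ 3 (periodsT3 F K) c₀ W₂)
    (hMf : ∀ X, Mf (toL2 F K c₀ X) = toL2 F K c₀ (fun b => Real.exp (φ b.src) • X b))
    (hMfi : ∀ X, Mfi (toL2 F K c₀ X) = toL2 F K c₀ (fun b => (Real.exp (φ b.src))⁻¹ • X b)) :
    (∀ x, ‖M (Qk F n K h c₀ cB U₀ (Mfi x)) - Qk F n K h c₀ cB U₀ x‖
        ≤ Real.sqrt (216 * (Real.exp (r * ((F.P K).d + 1)) - 1) ^ 2 * (cB / (c₀ * ((F.L : ℝ) ^ (K - n)) ^ 3))) * ‖x‖) ∧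
    (∀ c, ‖Mf (LinearMap.adjoint (Qk F n K h c₀ cB U₀) (Mi c)) - LinearMap.adjoint (Qk F n K h c₀ cB U₀) c‖
        ≤ Real.sqrt (216 * (Real.exp (r * ((F.P K).d + 1)) - 1) ^ 2 * (cB / (c₀ * ((F.L : ℝ) ^ (K - n)) ^ 3))) * ‖c‖) :=
  qkWeightConj_letters_exp_of_regPr F h c₀ cB hε₀ hε hε12 U₀ hreg φ hr hφ'
    (fun c => Site.fibreSite 0 (K - n) (bondShift (sites_eq F n K h) c).src fun _ => (⟨0, pow_pos (F.P K).L_pos (K - n)⟩ : Fin ((F.P K).L ^ (K - n))))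
    (fun c => iterBlockOf_src_corner F h c) M Mi hM hMi Mf Mfi hMf hMfi

end Letters

end Summit.QuantumFields.YangMills.Theorems.Prop7QkWeightConjugation

end
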